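import Literature.Probability.LatticeModels.PlusTruncationFreePair
import Literature.Probability.LatticeModels.PlanarIsingMultiPointCovariance
import Literature.Probability.LatticeModels.PlanarIsingTwoPointProofs
import HarnessLib

/-!
# CHI Lemma 2.26 (boundary decorrelation) for every number of spins, from CHI Theorem 1.1

Topic `Literature/Probability/LatticeModels`, namespace `Literature.Probability.LatticeModels`.
Chelkak–Hongler–Izyurov, *Conformal invariance of spin correlations in the planar Ising model*, Ann. of
Math. 181 (2015) = arXiv:1202.2838 (CHI), Lemma 2.26: given `Ω` with marked points `a₁, …, a_k` and
`η > 0` there is `ε > 0` such that for `a` `ε`-close to `∂Ω`,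
`1 - η ≤ 𝔼⁺_{Ω_δ}[σ_a] 𝔼⁺_{Ω_δ}[σ_{a₁}⋯σ_{a_k}] / 𝔼⁺_{Ω_δ}[σ_aσ_{a₁}⋯σ_{a_k}] ≤ 1` for all small `δ` — the
tree's hypothesis predicate `CHIBoundaryDecorrelation Ω` (`PlanarIsingMultiPointLimits.lean`), the last
discrete input of the assembly `chi_multiPoint_rho_of_twoPoint_CHI` (`PlanarIsingMultiPointCovariance.lean`)
besides CHI Thm 1.1, Prop 2.20 and Remark 2.21.

CHI prove the case `k = 1` by the GHS inequality and Theorem 1.1 (`𝓑_Ω(a;a₁) → 0` at the boundary), and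
the case `k ≥ 2` by an induction through Theorem 1.3 for fewer points in the two components of `Ω`
minus a crosscut (FKG), which in the tree's fixed discretisation scheme would require the approximability
(`MeshApproximates`) of such sub-domains. **This file proves the lemma for every `k` directly from
Theorem 1.1 (both boundary conditions), by the route of the case `k = 1`**: the GHS input is replaced by
the random-current inequality

  `𝔼⁺[σ_cσ_A] - 𝔼⁺[σ_c]𝔼⁺[σ_A] ≤ ∑_{j ∈ A} 𝔼⁺[σ_{A∖j}] · 𝔼^free[σ_cσ_j]`

(`isingCorr_plus_insert_sub_mul_le_sum`, `PlusTruncationFreePair.lean`; Aizenman–Fernández's (4.22) for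
spin products), whence with GKS II (`𝔼⁺[σ_{A∖j}]𝔼⁺[σ_cσ_j] ≤ 𝔼⁺[σ_cσ_A]`)

  `1 - 𝔼⁺[σ_c]𝔼⁺[σ_A]/𝔼⁺[σ_cσ_A] ≤ ∑_j 𝔼^free_{Ω_δ}[σ_cσ_{a_j}] / 𝔼⁺_{Ω_δ}[σ_cσ_{a_j}] → ∑_j 𝓑_Ω(c; a_j)`

(Thm 1.1 twice, `+` and free), and `𝓑_Ω(c; a_j) = 𝓑_ℍ(φc; φa_j) → 0` uniformly as `c → ∂Ω` (CHI Remark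
2.23; here `bCHI_sq_le` and a compactness argument through the Riemann map).

## Main statements

* `meshIsingPlusCorr_cons_sub_mul_le`, `meshIsingPlusCorr_erase_mul_pair_le` — the lattice inputs for the
  CHI correlations;
* `bCHI_sq_le`, `exists_bCHI_lt` — `𝓑_ℍ(w; v)² ≤ 4 Im v Im w / |v - w̄|²`, so `𝓑_ℍ(w;v) < η` once `Im w` is
  small or `|w|` is large;
* `chiBoundaryDecorrelation_of_twoPoint` — **CHI Lemma 2.26 for all `k` from CHI Thm 1.1 (`+` and free)**;
* `chi_multiPoint_rho_of_twoPoint_CHI'` — **CHI Theorem 1.3 (`chi_multiPoint_rho`) from CHI Thm 1.1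
  (both boundary conditions), Prop 2.20 (existence of ratio limits) and Remark 2.21 alone** (the
  hypothesis `hL` of `chi_multiPoint_rho_of_twoPoint_CHI` discharged);
* `chi_multiPoint_rho_of_ratios` — the same from Prop 2.20 (`k = 1` explicit form and all-`k`
  existence), Thm 1.7 and Remark 2.21, through `chi_twoPoint_rho_of_ratios`
  (`PlanarIsingTwoPointProofs.lean`, §2.9).

## References

* D. Chelkak, C. Hongler, K. Izyurov, Ann. of Math. 181 (2015) 1087–1138, arXiv:1202.2838: Lemma 2.26 and
  its proof, Remark 2.23, proof of Thm 1.3 (§2.10), Thm 1.1 [ChelkakHonglerIzyurovAnnals2015].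
* M. Aizenman, R. Fernández, J. Stat. Phys. 44 (1986), Prop. 4.7, (4.22) [AizenmanFernandezJSP1986].
-/

noncomputable section

open Filter Topology Set Metric
open scoped symmDiff
open Literature.Probability.LatticeModels

namespace Literature.Probability.LatticeModels

/-! ### The lattice inputs for the CHI correlations -/

section Lattice

variable {Ω : Set ℂ} {δ : ℝ} {n : ℕ} {c : ℂ} {A : Fin (n + 1) → ℂ}

/-- The rounded sites of the tuple with the `i`-th point removed are the rounded sites of the tuple minus
the `i`-th site. [folklore] -/
theorem image_nearestSite_succAbove (hinj : Function.Injective fun i => nearestSite δ (A i)) (i : Fin (n + 1)) :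
    (Finset.univ.image fun k => nearestSite δ (A (i.succAbove k))) =
      (Finset.univ.image fun k => nearestSite δ (A k)).erase (nearestSite δ (A i)) := by
  ext x
  simp only [Finset.mem_image, Finset.mem_univ, true_and, Finset.mem_erase, ne_eq]
  constructor
  · rintro ⟨k, rfl⟩
    exact ⟨fun h => Fin.succAbove_ne i k (hinj h), i.succAbove k, rfl⟩
  · rintro ⟨hx, k, rfl⟩
    have hki : k ≠ i := fun h => hx (by rw [h])
    obtain ⟨z, hz⟩ := Fin.exists_succAbove_eq hki
    exact ⟨z, by rw [hz]⟩

/-- `𝔼⁺_{Ω_δ}` of the tuple with the `i`-th point removed is the correlation of the rounded sites minus the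
`i`-th one. [folklore] -/
theorem meshIsingPlusCorr_succAbove_eq (hinj : Function.Injective fun i => nearestSite δ (A i))
    (i : Fin (n + 1)) :
    meshIsingPlusCorr Ω δ (fun k => A (i.succAbove k)) =
      isingCorr (discreteDomainGraph Ω δ) (meshInteriorFinset Ω δ) criticalBetaTwo 0 .plus
        ((Finset.univ.image fun k => nearestSite δ (A k)).erase (nearestSite δ (A i))) := by
  have hinj' : Function.Injective fun k => nearestSite δ (A (i.succAbove k)) :=
    fun k l h => Fin.succAbove_right_injective (hinj h)
  rw [meshIsingPlusCorr_eq_isingCorr_image Ω δ hinj', image_nearestSite_succAbove hinj i]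

/-- `(S ∖ j) ∆ {c, j} = {c} ∆ S` for `j ∈ S`, `c ∉ S`. [folklore] -/
theorem erase_symmDiff_pair {V : Type*} [DecidableEq V] {S : Finset V} {c j : V} (hj : j ∈ S) (hc : c ∉ S) :
    S.erase j ∆ {c, j} = {c} ∆ S := by
  have hcj : c ≠ j := fun h => hc (h ▸ hj)
  ext x
  simp only [Finset.mem_symmDiff, Finset.mem_erase, Finset.mem_insert, Finset.mem_singleton, ne_eq]
  by_cases hxc : x = c
  · subst hxc; simp [hc, hcj]
  · by_cases hxj : x = j
    · subst hxj; simp [hj, hxc]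
    · simp [hxc, hxj]

/-- **The truncation bound for the CHI correlations**: once all rounded sites are free, those of the `aᵢ`
distinct and different from `[c/δ]`,
`𝔼⁺[σ_cσ_{a₀}⋯σ_{a_n}] - 𝔼⁺[σ_c]𝔼⁺[σ_{a₀}⋯σ_{a_n}] ≤ ∑ᵢ 𝔼⁺[∏_{k ≠ i} σ_{a_k}] · 𝔼^free[σ_cσ_{aᵢ}]`
(`isingCorr_plus_insert_sub_mul_le_sum`). [cite: AizenmanFernandezJSP1986, §4.3, Proposition 4.7, eq. (4.22)] -/
theorem meshIsingPlusCorr_cons_sub_mul_le (hc : nearestSite δ c ∈ meshInteriorFinset Ω δ)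
    (hA : ∀ i, nearestSite δ (A i) ∈ meshInteriorFinset Ω δ)
    (hinj : Function.Injective fun i => nearestSite δ (A i)) (hcA : ∀ i, nearestSite δ c ≠ nearestSite δ (A i)) :
    meshIsingPlusCorr Ω δ (Matrix.vecCons c A) - meshIsingPlusCorr Ω δ ![c] * meshIsingPlusCorr Ω δ A ≤
      ∑ i, meshIsingPlusCorr Ω δ (fun k => A (i.succAbove k)) * meshIsingFreeCorr Ω δ ![c, A i] := by
  classical
  set S := Finset.univ.image fun k => nearestSite δ (A k) with hS
  have hSΛ : S ⊆ meshInteriorFinset Ω δ := by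
    intro x hx
    obtain ⟨k, -, rfl⟩ := Finset.mem_image.1 hx
    exact hA k
  have hcS : nearestSite δ c ∉ S := by
    intro h
    obtain ⟨k, -, hk⟩ := Finset.mem_image.1 h
    exact hcA k hk.symm
  have hcons : meshIsingPlusCorr Ω δ (Matrix.vecCons c A) =
      isingCorr (discreteDomainGraph Ω δ) (meshInteriorFinset Ω δ) criticalBetaTwo 0 .plus
        (insert (nearestSite δ c) S) := by
    rw [meshIsingPlusCorr_cons_eq_isingCorr_symmDiff Ω δ hinj, ← hS,
      (Finset.disjoint_singleton_left.2 hcS).symmDiff_eq_sup, Finset.sup_eq_union, Finset.insert_eq]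
  rw [hcons, meshIsingPlusCorr_one_eq, meshIsingPlusCorr_eq_isingCorr_image Ω δ hinj, ← hS]
  refine le_trans (isingCorr_plus_insert_sub_mul_le_sum criticalBetaTwo_pos.le hSΛ hc hcS) (le_of_eq ?_)
  rw [hS, Finset.sum_image fun i _ j _ h => hinj h]
  refine Finset.sum_congr rfl fun i _ => ?_
  rw [meshIsingPlusCorr_succAbove_eq hinj, meshIsingFreeCorr_two_eq Ω δ (hcA i)]

/-- **GKS II for the CHI correlations**: `𝔼⁺[∏_{k ≠ i} σ_{a_k}] · 𝔼⁺[σ_cσ_{aᵢ}] ≤ 𝔼⁺[σ_cσ_{a₀}⋯σ_{a_n}]`.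
[cite: FriedliVelenik2017, Thm. 3.20, eq. (3.22)] -/
theorem meshIsingPlusCorr_erase_mul_pair_le (hc : nearestSite δ c ∈ meshInteriorFinset Ω δ)
    (hA : ∀ i, nearestSite δ (A i) ∈ meshInteriorFinset Ω δ)
    (hinj : Function.Injective fun i => nearestSite δ (A i)) (hcA : ∀ i, nearestSite δ c ≠ nearestSite δ (A i))
    (i : Fin (n + 1)) :
    meshIsingPlusCorr Ω δ (fun k => A (i.succAbove k)) * meshIsingPlusCorr Ω δ ![c, A i] ≤
      meshIsingPlusCorr Ω δ (Matrix.vecCons c A) := by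
  set S := Finset.univ.image fun k => nearestSite δ (A k) with hS
  have hSΛ : S ⊆ meshInteriorFinset Ω δ := by
    intro x hx
    obtain ⟨k, -, rfl⟩ := Finset.mem_image.1 hx
    exact hA k
  have hcS : nearestSite δ c ∉ S := by
    intro h
    obtain ⟨k, -, hk⟩ := Finset.mem_image.1 h
    exact hcA k hk.symm
  have hiS : nearestSite δ (A i) ∈ S := Finset.mem_image.2 ⟨i, Finset.mem_univ i, rfl⟩
  rw [meshIsingPlusCorr_succAbove_eq hinj i, ← hS, meshIsingPlusCorr_two_eq Ω δ (hcA i),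
    meshIsingPlusCorr_cons_eq_isingCorr_symmDiff Ω δ hinj, ← hS, ← erase_symmDiff_pair hiS hcS]
  refine GKSInequalities.gks_two_holds (discreteDomainGraph Ω δ) criticalBetaTwo_pos.le le_rfl
    (Or.inr rfl) ((Finset.erase_subset _ _).trans hSΛ) ?_
  intro x hx
  simp only [Finset.mem_insert, Finset.mem_singleton] at hx
  rcases hx with rfl | rfl
  · exact hc
  · exact hA i

end Lattice

/-! ### `𝓑_ℍ → 0` at the boundary: explicit bounds -/

/-- `|v - w̄|² = |v - w|² + 4 Im v Im w`. [folklore] -/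
theorem norm_sub_conj_sq (v w : ℂ) :
    ‖v - (starRingEnd ℂ) w‖ ^ 2 = ‖v - w‖ ^ 2 + 4 * v.im * w.im := by
  rw [← Complex.normSq_eq_norm_sq, ← Complex.normSq_eq_norm_sq, Complex.normSq_apply, Complex.normSq_apply]
  simp only [Complex.sub_re, Complex.sub_im, Complex.conj_re, Complex.conj_im]
  ring

/-- `𝓑 ≥ 0`. [cite: ChelkakHonglerIzyurovAnnals2015, eq. (1.3)] -/
theorem bCHI_nonneg (w v : ℂ) : 0 ≤ bCHI w v := by
  unfold bCHI; exact div_nonneg (Real.sqrt_nonneg _) (Real.sqrt_nonneg _)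

/-- **`𝓑_ℍ(w; v)² ≤ 4 Im v Im w / |v - w̄|²`** for `w ≠ v` in `ℍ`: with `r = |v-w|/|v-w̄| ∈ (0,1]` and
`u = r^{1/2}` one has `𝓑² = (u⁻¹ - u)/(u + u⁻¹) = (1 - r)/(1 + r) ≤ 1 - r² = 4 Im v Im w/|v - w̄|²`.
[cite: ChelkakHonglerIzyurovAnnals2015, Remark 2.23 (𝓑_Ω(a;b) → 0 as a → ∂Ω)] -/
theorem bCHI_sq_le {w v : ℂ} (hw : 0 < w.im) (hv : 0 < v.im) (hwv : w ≠ v) :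
    bCHI w v ^ 2 ≤ 4 * v.im * w.im / ‖v - (starRingEnd ℂ) w‖ ^ 2 := by
  set d := ‖v - w‖ with hd
  set D := ‖v - (starRingEnd ℂ) w‖ with hD
  have hd0 : 0 < d := norm_pos_iff.2 (sub_ne_zero.2 (Ne.symm hwv))
  have hD2 : D ^ 2 = d ^ 2 + 4 * v.im * w.im := norm_sub_conj_sq v w
  have hD2pos : 0 < D ^ 2 := by rw [hD2]; positivity
  have hDnn : 0 ≤ D := norm_nonneg _
  have hDpos : 0 < D := by
    rcases hDnn.lt_or_eq with h | h
    · exact h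
    · exfalso; rw [← h] at hD2pos; simp at hD2pos
  set r := d / D with hr
  have hr0 : 0 < r := div_pos hd0 hDpos
  have hdD : d ≤ D := by nlinarith [hd0, hDpos, mul_pos hv hw]
  have hr1 : r ≤ 1 := (div_le_one hDpos).2 hdD
  -- `u = √r`
  set s := Real.sqrt r with hs
  have hu : uCHI w v = s := by rw [hs, hr, hd, hD, uCHI, Real.sqrt_eq_rpow]
  have hs0 : 0 < s := Real.sqrt_pos.2 hr0
  have hs2 : s ^ 2 = r := Real.sq_sqrt hr0.le
  have h1 : s⁻¹ - s = (1 - r) / s := by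
    rw [eq_div_iff hs0.ne', sub_mul, inv_mul_cancel₀ hs0.ne', ← pow_two, hs2]
  have h2 : s + s⁻¹ = (1 + r) / s := by
    rw [eq_div_iff hs0.ne', add_mul, inv_mul_cancel₀ hs0.ne', ← pow_two, hs2, add_comm]
  have hsub : 0 ≤ s⁻¹ - s := by rw [h1]; exact div_nonneg (sub_nonneg.2 hr1) hs0.le
  have hadd : 0 < s + s⁻¹ := by positivity
  have hb : bCHI w v ^ 2 = (1 - r) / (1 + r) := by
    unfold bCHI
    rw [hu, div_pow, Real.sq_sqrt hsub, Real.sq_sqrt hadd.le, h1, h2, div_div_div_cancel_right₀ hs0.ne']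
  rw [hb]
  have hkey : 4 * v.im * w.im / D ^ 2 = 1 - r ^ 2 := by
    rw [hr, div_pow, hD2]
    field_simp
    ring
  rw [hkey, div_le_iff₀ (by linarith)]
  nlinarith [sub_nonneg.2 hr1, hr0]

/-- **`𝓑_ℍ(w; v) < η` near `∂ℍ ∪ {∞}`**: for `v ∈ ℍ` and `η > 0` there are `m, R > 0` such that
`𝓑_ℍ(w; v) < η` for every `w ∈ ℍ ∖ {v}` with `Im w < m` or `|w| > R` (CHI Remark 2.23: "`𝓑_Ω(a;b) → 0` as
`a → ∂Ω`"). [cite: ChelkakHonglerIzyurovAnnals2015, Remark 2.23] -/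
theorem exists_bCHI_lt {v : ℂ} (hv : 0 < v.im) {η : ℝ} (hη : 0 < η) :
    ∃ m > 0, ∃ R > 0, ∀ w : ℂ, 0 < w.im → w ≠ v → (w.im < m ∨ R < ‖w‖) → bCHI w v < η := by
  refine ⟨η ^ 2 * v.im / 4, by positivity, max (2 * ‖v‖) (16 * v.im / η ^ 2) + 1, by positivity, ?_⟩
  intro w hw hwv hcase
  have hsq := bCHI_sq_le hw hv hwv
  have hD2 := norm_sub_conj_sq v w
  suffices h : bCHI w v ^ 2 < η ^ 2 from lt_of_abs_lt (abs_lt_of_sq_lt_sq h hη.le)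
  rcases hcase with h | h
  · -- `Im w` small
    have him : (v.im - w.im) ^ 2 ≤ ‖v - w‖ ^ 2 := by
      have h1 := Complex.abs_im_le_norm (v - w)
      rw [Complex.sub_im] at h1
      nlinarith [abs_nonneg (v.im - w.im), sq_abs (v.im - w.im), norm_nonneg (v - w)]
    have hD2ge : v.im ^ 2 ≤ ‖v - (starRingEnd ℂ) w‖ ^ 2 := by
      rw [hD2]; nlinarith [mul_pos hv hw]
    calc bCHI w v ^ 2 ≤ 4 * v.im * w.im / ‖v - (starRingEnd ℂ) w‖ ^ 2 := hsq
      _ ≤ 4 * v.im * w.im / v.im ^ 2 := div_le_div_of_nonneg_left (by positivity) (by positivity) hD2ge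
      _ = 4 * w.im / v.im := by field_simp
      _ < 4 * (η ^ 2 * v.im / 4) / v.im := by gcongr
      _ = η ^ 2 := by field_simp
  · -- `|w|` large
    have hw2 : 2 * ‖v‖ < ‖w‖ := by linarith [le_max_left (2 * ‖v‖) (16 * v.im / η ^ 2)]
    have hw16 : 16 * v.im / η ^ 2 < ‖w‖ := by linarith [le_max_right (2 * ‖v‖) (16 * v.im / η ^ 2)]
    have hwpos : 0 < ‖w‖ := by linarith [norm_nonneg v]
    have hDge : ‖w‖ / 2 ≤ ‖v - (starRingEnd ℂ) w‖ := by
      have h1 := norm_sub_norm_le ((starRingEnd ℂ) w) v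
      rw [Complex.norm_conj, norm_sub_rev] at h1
      linarith
    have hD2ge : ‖w‖ ^ 2 / 4 ≤ ‖v - (starRingEnd ℂ) w‖ ^ 2 := by nlinarith [norm_nonneg w]
    have him : w.im ≤ ‖w‖ := le_trans (le_abs_self _) (Complex.abs_im_le_norm w)
    calc bCHI w v ^ 2 ≤ 4 * v.im * w.im / ‖v - (starRingEnd ℂ) w‖ ^ 2 := hsq
      _ ≤ 4 * v.im * ‖w‖ / (‖w‖ ^ 2 / 4) :=
          div_le_div₀ (by positivity) (by gcongr) (by positivity) hD2ge
      _ = 16 * v.im / ‖w‖ := by field_simp; ring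
      _ < 16 * v.im / (16 * v.im / η ^ 2) := div_lt_div_of_pos_left (by positivity) (by positivity) hw16
      _ = η ^ 2 := by field_simp

/-! ### Compactness: points of a compact subset of `Ω` are uniformly far from `∂Ω` -/

/-- A compact subset of a bounded open set is at positive distance from its complement. [folklore] -/
theorem exists_pos_forall_le_infDist {Ω K : Set ℂ} (hΩ : IsOpen Ω) (hb : Bornology.IsBounded Ω)
    (hK : IsCompact K) (hKΩ : K ⊆ Ω) : ∃ ε > 0, ∀ z ∈ K, ε ≤ infDist z Ωᶜ := by
  rcases K.eq_empty_or_nonempty with rfl | hne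
  · exact ⟨1, one_pos, fun z hz => hz.elim⟩
  · obtain ⟨z₀, hz₀, hmin⟩ := hK.exists_isMinOn hne (continuous_infDist_pt (Ωᶜ : Set ℂ)).continuousOn
    have hU : Ω ≠ univ := by
      rintro rfl
      exact NormedSpace.unbounded_univ ℂ ℂ hb
    have hcne : (Ωᶜ : Set ℂ).Nonempty := Set.nonempty_compl.2 hU
    have hpos : 0 < infDist z₀ Ωᶜ := by
      rw [← infDist_pos_iff_notMem_closure hcne, hΩ.isClosed_compl.closure_eq]
      exact fun h => h (hKΩ hz₀)
    exact ⟨_, hpos, fun z hz => hmin hz⟩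

/-- A point of an open bounded set is at positive distance from the complement. [folklore] -/
theorem infDist_compl_pos {Ω : Set ℂ} (hΩ : IsOpen Ω) (hb : Bornology.IsBounded Ω) {z : ℂ} (hz : z ∈ Ω) :
    0 < infDist z Ωᶜ := by
  obtain ⟨ε, hε, h⟩ := exists_pos_forall_le_infDist hΩ hb isCompact_singleton (Set.singleton_subset_iff.2 hz)
  exact lt_of_lt_of_le hε (h z rfl)

/-! ### CHI Lemma 2.26 for all `k` from Theorem 1.1 -/

/-- **`𝔼^free_{Ω_δ}[σ_xσ_y] ≤ η 𝔼⁺_{Ω_δ}[σ_xσ_y]` eventually, once `𝓑_ℍ(φx; φy) < η`** (CHI Thm 1.1 twice: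
`𝔼^free[σ_xσ_y]/𝔼⁺[σ_xσ_y] → ⟨σ_xσ_y⟩^free_Ω/⟨σ_xσ_y⟩⁺_Ω = 𝓑`; the first half of
`eventually_decorr_of_bCHI_lt` of `PlanarIsingOnePointProofs.lean`). [cite: ChelkakHonglerIzyurovAnnals2015, §2.10, proof of Lemma 2.26; Thm. 1.1 and Thm. 1.7] -/
theorem eventually_free_le_mul_plus {Ω : Set ℂ} (hΩ : IsAdmissibleDomain Ω) {φ : ℂ → ℂ}
    (hφ : IsConformalBijection φ Ω UpperHalfPlane.upperHalfPlaneSet) {x y : ℂ} (hx : x ∈ Ω)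
    (hy : y ∈ Ω) (hxy : x ≠ y)
    (hT : Tendsto (fun δ => meshIsingPlusCorr Ω δ ![x, y] / rhoCHI δ) (𝓝[>] 0)
      (𝓝 (twoPointPlusCHI φ x y)))
    (hTf : Tendsto (fun δ => meshIsingFreeCorr Ω δ ![x, y] / rhoCHI δ) (𝓝[>] 0)
      (𝓝 (twoPointFreeCHI φ x y)))
    {η : ℝ} (hB : bCHI (φ x) (φ y) < η) :
    ∀ᶠ δ in 𝓝[>] (0 : ℝ), meshIsingFreeCorr Ω δ ![x, y] ≤ η * meshIsingPlusCorr Ω δ ![x, y] := by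
  have hφx : 0 < (φ x).im := hφ.2.mapsTo hx
  have hφy : 0 < (φ y).im := hφ.2.mapsTo hy
  have hw1 : φ y ≠ φ x := fun h => hxy (hφ.2.injOn hx hy h.symm)
  have hw2 : φ y ≠ (starRingEnd ℂ) (φ x) := fun h => by
    have h' := congrArg Complex.im h
    rw [Complex.conj_im] at h'
    linarith
  have hdx : deriv φ x ≠ 0 :=
    Literature.Analysis.Complex.SCV.deriv_ne_zero_of_injOn hφ.1 hΩ.1 hφ.2.injOn hx
  have hdy : deriv φ y ≠ 0 :=
    Literature.Analysis.Complex.SCV.deriv_ne_zero_of_injOn hφ.1 hΩ.1 hφ.2.injOn hy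
  have hLx : 0 < onePointPlusCHI φ x := onePointPlusCHI_pos hdx hφx
  have hLy : 0 < onePointPlusCHI φ y := onePointPlusCHI_pos hdy hφy
  have hPlus : 0 < twoPointPlusCHI φ x y := by
    rw [twoPointPlusCHI_eq_mul_ratioCHI hφx hφy]
    exact mul_pos (mul_pos hLx hLy) (lt_of_lt_of_le one_pos (one_le_ratioCHI hw1 hw2))
  have hpos : ∀ᶠ δ in 𝓝[>] (0 : ℝ), 0 < meshIsingPlusCorr Ω δ ![x, y] / rhoCHI δ :=
    hT.eventually_const_lt hPlus
  have hratio : Tendsto (fun δ => meshIsingFreeCorr Ω δ ![x, y] / meshIsingPlusCorr Ω δ ![x, y])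
      (𝓝[>] 0) (𝓝 (bCHI (φ x) (φ y))) := by
    have h := hTf.div hT hPlus.ne'
    rw [twoPointFreeCHI_eq_mul_bCHI hw1 hw2, mul_div_cancel_left₀ _ hPlus.ne'] at h
    refine h.congr' ?_
    filter_upwards [hpos] with δ hδ
    have hρ : rhoCHI δ ≠ 0 := by
      intro h0
      rw [h0, div_zero] at hδ
      exact lt_irrefl 0 hδ
    simp only [Pi.div_apply]
    rw [div_div_div_cancel_right₀ hρ]
  filter_upwards [hratio.eventually_lt_const hB, hpos] with δ hr hp
  have hP2 : 0 < meshIsingPlusCorr Ω δ ![x, y] := by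
    rcases div_pos_iff.1 hp with h | h
    · exact h.1
    · exact absurd h.2 (not_lt.2 (rhoCHI_nonneg δ))
  exact (div_le_iff₀ hP2).1 hr.le

/-- **CHI Lemma 2.26 for every number of spins, from CHI Theorem 1.1 (`+` and free boundary
conditions).** For an admissible `Ω` with `MeshApproximates Ω`, assume CHI Thm 1.1 in `Ω` for every
conformal `φ : Ω → ℍ` and all distinct `x, y ∈ Ω`: `𝔼⁺_{Ω_δ}[σ_xσ_y]/ϱ(δ) → ⟨σ_xσ_y⟩⁺_Ω` (`hT`) and
`𝔼^free_{Ω_δ}[σ_xσ_y]/ϱ(δ) → ⟨σ_xσ_y⟩^free_Ω` (`hTf`). Then `CHIBoundaryDecorrelation Ω`: for distinct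
`a₀, …, a_n ∈ Ω` and `η > 0` there is `ε > 0` such that every `c ∈ Ω` with `dist(c, Ωᶜ) < ε` satisfies
`(1 - η) 𝔼⁺_{Ω_δ}[σ_cσ_{a₀}⋯σ_{a_n}] ≤ 𝔼⁺_{Ω_δ}[σ_c] 𝔼⁺_{Ω_δ}[σ_{a₀}⋯σ_{a_n}]` for all small `δ`. Proof:
`𝔼⁺[σ_cσ_A] - 𝔼⁺[σ_c]𝔼⁺[σ_A] ≤ ∑ᵢ 𝔼⁺[σ_{A∖i}]𝔼^free[σ_cσ_{aᵢ}] ≤ ∑ᵢ 𝓑ᵢ' 𝔼⁺[σ_{A∖i}]𝔼⁺[σ_cσ_{aᵢ}] ≤ (n+1) η' 𝔼⁺[σ_cσ_A]`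
(`meshIsingPlusCorr_cons_sub_mul_le`, Thm 1.1 through `eventually_free_le_mul_plus`, GKS II), where
`𝓑_ℍ(ψc; ψaᵢ) < η' = η/(n+1)` for all `i` as soon as `c` avoids the compact set `ψ⁻¹{Im ≥ m, |·| ≤ R}`
(`exists_bCHI_lt`, `ψ` the Riemann map followed by the inverse Cayley transform).
[cite: ChelkakHonglerIzyurovAnnals2015, Lemma 2.26 (all k); Thm. 1.1; Remark 2.23] -/
theorem chiBoundaryDecorrelation_of_twoPoint {Ω : Set ℂ} (hΩ : IsAdmissibleDomain Ω)
    (hM : MeshApproximates Ω)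
    (hT : ∀ φ : ℂ → ℂ, IsConformalBijection φ Ω UpperHalfPlane.upperHalfPlaneSet →
      ∀ x ∈ Ω, ∀ y ∈ Ω, x ≠ y →
        Tendsto (fun δ => meshIsingPlusCorr Ω δ ![x, y] / rhoCHI δ) (𝓝[>] 0)
          (𝓝 (twoPointPlusCHI φ x y)))
    (hTf : ∀ φ : ℂ → ℂ, IsConformalBijection φ Ω UpperHalfPlane.upperHalfPlaneSet →
      ∀ x ∈ Ω, ∀ y ∈ Ω, x ≠ y →
        Tendsto (fun δ => meshIsingFreeCorr Ω δ ![x, y] / rhoCHI δ) (𝓝[>] 0)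
          (𝓝 (twoPointFreeCHI φ x y))) :
    CHIBoundaryDecorrelation Ω := by
  intro n A hA hAΩ η hη
  have hopen : IsOpen Ω := hΩ.1
  have hbdd : Bornology.IsBounded Ω := hΩ.2.1
  -- the conformal map `ψ : Ω → ℍ` (inverse Cayley after the Riemann map) and its inverse `ρ`
  obtain ⟨hd, hbij, -, hinv⟩ := riemannMapBall_spec hΩ
  set ψ : ℂ → ℂ := fun z => RandomPlanarGeometry.cayleyInvFun (riemannMapBall Ω z) with hψ
  have hψc : IsConformalBijection ψ Ω UpperHalfPlane.upperHalfPlaneSet :=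
    ⟨SlitDisc.isConformalBijection_cayleyInvFun.1.comp hd hbij.mapsTo,
      SlitDisc.isConformalBijection_cayleyInvFun.2.comp hbij⟩
  set ρ : ℂ → ℂ := fun w => Function.invFunOn (riemannMapBall Ω) Ω (RandomPlanarGeometry.cayleyFun w)
    with hρ
  have hρψ : ∀ z ∈ Ω, ρ (ψ z) = z := by
    intro z hz
    have hne1 : riemannMapBall Ω z ≠ 1 := by
      intro h1
      have hmem := hbij.mapsTo hz
      rw [h1, mem_ball_zero_iff, norm_one] at hmem
      exact lt_irrefl _ hmem
    show Function.invFunOn (riemannMapBall Ω) Ω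
        (RandomPlanarGeometry.cayleyFun (RandomPlanarGeometry.cayleyInvFun (riemannMapBall Ω z))) = z
    rw [RandomPlanarGeometry.cayleyFun_cayleyInvFun hne1]
    exact hbij.invOn_invFunOn.1 hz
  have hρcont : ContinuousOn ρ UpperHalfPlane.upperHalfPlaneSet := by
    refine hinv.continuousOn.comp (RandomPlanarGeometry.continuousOn_cayleyFun.mono ?_) ?_
    · intro w hw
      exact RandomPlanarGeometry.add_I_ne_zero (le_of_lt hw)
    · exact RandomPlanarGeometry.cayley.mapsTo
  have hρmaps : MapsTo ρ UpperHalfPlane.upperHalfPlaneSet Ω := fun w hw =>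
    hbij.surjOn.mapsTo_invFunOn (RandomPlanarGeometry.cayley.mapsTo hw)
  -- `η' = η / (n + 1)` and the smallness data at each marked point
  set η' : ℝ := η / (n + 1) with hη'
  have hη'pos : 0 < η' := by positivity
  have hsmall : ∀ i : Fin (n + 1), ∃ m > 0, ∃ R > 0, ∀ w : ℂ, 0 < w.im → w ≠ ψ (A i) →
      (w.im < m ∨ R < ‖w‖) → bCHI w (ψ (A i)) < η' :=
    fun i => exists_bCHI_lt (hψc.2.mapsTo (hAΩ i)) hη'pos
  choose m hm R hR hmR using hsmall
  set m₀ : ℝ := Finset.univ.inf' Finset.univ_nonempty m with hm₀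
  set R₀ : ℝ := Finset.univ.sup' Finset.univ_nonempty R with hR₀
  have hm₀pos : 0 < m₀ := (Finset.lt_inf'_iff _).2 fun i _ => hm i
  have hm₀le : ∀ i, m₀ ≤ m i := fun i => Finset.inf'_le _ (Finset.mem_univ i)
  have hR₀ge : ∀ i, R i ≤ R₀ := fun i => Finset.le_sup' _ (Finset.mem_univ i)
  -- the compact set `K = ψ⁻¹ {Im ≥ m₀, |·| ≤ R₀}`
  set C : Set ℂ := {w | m₀ ≤ w.im ∧ ‖w‖ ≤ R₀} with hC
  have hCclosed : IsClosed C :=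
    (isClosed_le continuous_const Complex.continuous_im).inter (isClosed_le continuous_norm continuous_const)
  have hCbdd : Bornology.IsBounded C :=
    (isBounded_closedBall (x := (0 : ℂ)) (r := R₀)).subset fun w hw => mem_closedBall_zero_iff.2 hw.2
  have hCcpt : IsCompact C := isCompact_of_isClosed_isBounded hCclosed hCbdd
  have hCH : C ⊆ UpperHalfPlane.upperHalfPlaneSet := fun w hw => lt_of_lt_of_le hm₀pos hw.1
  set K : Set ℂ := ρ '' C with hK
  have hKcpt : IsCompact K := hCcpt.image_of_continuousOn (hρcont.mono hCH)
  have hKΩ : K ⊆ Ω := by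
    rintro _ ⟨w, hw, rfl⟩
    exact hρmaps (hCH hw)
  obtain ⟨ε₁, hε₁, hKε⟩ := exists_pos_forall_le_infDist hopen hbdd hKcpt hKΩ
  -- the marked points are at positive distance from the boundary
  set ε₂ : ℝ := Finset.univ.inf' Finset.univ_nonempty fun i => infDist (A i) Ωᶜ with hε₂
  have hε₂pos : 0 < ε₂ := (Finset.lt_inf'_iff _).2 fun i _ => infDist_compl_pos hopen hbdd (hAΩ i)
  have hε₂le : ∀ i, ε₂ ≤ infDist (A i) Ωᶜ := fun i =>
    Finset.inf'_le (fun i => infDist (A i) Ωᶜ) (Finset.mem_univ i)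
  refine ⟨min ε₁ ε₂, lt_min hε₁ hε₂pos, fun c hcΩ hcε => ?_⟩
  have hcε₁ : infDist c Ωᶜ < ε₁ := lt_of_lt_of_le hcε (min_le_left _ _)
  have hcA : ∀ i, c ≠ A i := fun i h => by
    have h2 : infDist c Ωᶜ < infDist (A i) Ωᶜ :=
      lt_of_lt_of_le (lt_of_lt_of_le hcε (min_le_right _ _)) (hε₂le i)
    rw [h] at h2
    exact lt_irrefl _ h2
  -- `ψ c ∉ C`, hence `Im ψc < m₀` or `|ψ c| > R₀`, hence all `𝓑` are small
  have hψcC : ψ c ∉ C := fun h => by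
    have hcK : c ∈ K := ⟨ψ c, h, hρψ c hcΩ⟩
    exact absurd (hKε c hcK) (not_le.2 hcε₁)
  have hcase : (ψ c).im < m₀ ∨ R₀ < ‖ψ c‖ := by
    by_contra h
    push Not at h
    exact hψcC ⟨h.1, h.2⟩
  have hBi : ∀ i, bCHI (ψ c) (ψ (A i)) < η' := fun i =>
    hmR i (ψ c) (hψc.2.mapsTo hcΩ) (fun h => hcA i (hψc.2.injOn hcΩ (hAΩ i) h))
      (hcase.imp (fun h => lt_of_lt_of_le h (hm₀le i)) fun h => lt_of_le_of_lt (hR₀ge i) h)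
  -- eventual lattice facts
  have hfree : ∀ i, ∀ᶠ δ in 𝓝[>] (0 : ℝ),
      meshIsingFreeCorr Ω δ ![c, A i] ≤ η' * meshIsingPlusCorr Ω δ ![c, A i] := fun i =>
    eventually_free_le_mul_plus hΩ hψc hcΩ (hAΩ i) (hcA i)
      (hT ψ hψc c hcΩ (A i) (hAΩ i) (hcA i)) (hTf ψ hψc c hcΩ (A i) (hAΩ i) (hcA i)) (hBi i)
  filter_upwards [eventually_all.2 hfree, eventually_nearestSite_mem_meshInteriorFinset hM hcΩ,
    eventually_forall_nearestSite_mem hM hAΩ, eventually_nearestSite_injective hA,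
    eventually_all.2 fun i => eventually_nearestSite_ne (hcA i)] with δ hfr hcs hAs hinj hne
  have hmain := meshIsingPlusCorr_cons_sub_mul_le hcs hAs hinj hne
  have hprod := meshIsingPlusCorr_erase_mul_pair_le hcs hAs hinj hne
  have hnn : ∀ i : Fin (n + 1), 0 ≤ meshIsingPlusCorr Ω δ (fun k => A (i.succAbove k)) := fun i =>
    meshIsingPlusCorr_nonneg (fun k => hAs _) fun k l h => Fin.succAbove_right_injective (hinj h)
  have hsum : ∑ i, meshIsingPlusCorr Ω δ (fun k => A (i.succAbove k)) * meshIsingFreeCorr Ω δ ![c, A i] ≤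
      ∑ _i : Fin (n + 1), η' * meshIsingPlusCorr Ω δ (Matrix.vecCons c A) := by
    refine Finset.sum_le_sum fun i _ => ?_
    calc meshIsingPlusCorr Ω δ (fun k => A (i.succAbove k)) * meshIsingFreeCorr Ω δ ![c, A i]
        ≤ meshIsingPlusCorr Ω δ (fun k => A (i.succAbove k)) * (η' * meshIsingPlusCorr Ω δ ![c, A i]) :=
          mul_le_mul_of_nonneg_left (hfr i) (hnn i)
      _ = η' * (meshIsingPlusCorr Ω δ (fun k => A (i.succAbove k)) * meshIsingPlusCorr Ω δ ![c, A i]) := by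
          ring
      _ ≤ η' * meshIsingPlusCorr Ω δ (Matrix.vecCons c A) :=
          mul_le_mul_of_nonneg_left (hprod i) hη'pos.le
  rw [Finset.sum_const, Finset.card_univ, Fintype.card_fin, nsmul_eq_mul] at hsum
  have hηn : ((n + 1 : ℕ) : ℝ) * (η' * meshIsingPlusCorr Ω δ (Matrix.vecCons c A)) =
      η * meshIsingPlusCorr Ω δ (Matrix.vecCons c A) := by
    rw [hη', Nat.cast_add_one]
    field_simp
  rw [hηn] at hsum
  linarith

/-! ### CHI Theorem 1.3 from Theorem 1.1, Proposition 2.20 and Remark 2.21 -/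

/-- **CHI Theorem 1.3 for all `k` (`chi_multiPoint_rho`) from CHI Theorem 1.1 (both boundary
conditions), Proposition 2.20 (existence of the ratio limits) and Remark 2.21 (their covariance)** —
`chi_multiPoint_rho_of_twoPoint_CHI` of `PlanarIsingMultiPointCovariance.lean` with its hypothesis `hL`
(CHI Lemma 2.26 for all `k`) discharged by `chiBoundaryDecorrelation_of_twoPoint`. Every remaining
hypothesis is a binder for a published result of CHI whose printed proof is the convergence theory of the
discrete spinor observables (CHI §§2.2–2.9, §3). [cite: ChelkakHonglerIzyurovAnnals2015, Thm. 1.3; Thm. 1.1, Prop. 2.20, Remark 2.21, Lemma 2.26, §2.10] -/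
theorem chi_multiPoint_rho_of_twoPoint_CHI'
    (hT : ∀ (Ω : Set ℂ), IsAdmissibleDomain Ω → MeshApproximates Ω → ∀ (φ : ℂ → ℂ),
      IsConformalBijection φ Ω UpperHalfPlane.upperHalfPlaneSet → ∀ x ∈ Ω, ∀ y ∈ Ω, x ≠ y →
        Tendsto (fun δ => meshIsingPlusCorr Ω δ ![x, y] / rhoCHI δ) (𝓝[>] 0)
          (𝓝 (twoPointPlusCHI φ x y)))
    (hTf : ∀ (Ω : Set ℂ), IsAdmissibleDomain Ω → MeshApproximates Ω → ∀ (φ : ℂ → ℂ),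
      IsConformalBijection φ Ω UpperHalfPlane.upperHalfPlaneSet → ∀ x ∈ Ω, ∀ y ∈ Ω, x ≠ y →
        Tendsto (fun δ => meshIsingFreeCorr Ω δ ![x, y] / rhoCHI δ) (𝓝[>] 0)
          (𝓝 (twoPointFreeCHI φ x y)))
    (hP : ∀ Ω : Set ℂ, IsAdmissibleDomain Ω → MeshApproximates Ω → CHIRatioLimits Ω)
    (hR : ∀ (Ω Ω' : Set ℂ) (φ : ℂ → ℂ), IsAdmissibleDomain Ω → MeshApproximates Ω →
      IsAdmissibleDomain Ω' → MeshApproximates Ω' → IsConformalBijection φ Ω Ω' →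
        CHIRatioCovariance Ω Ω' φ) :
    chi_multiPoint_rho :=
  chi_multiPoint_rho_of_twoPoint_CHI hT hTf hP
    (fun Ω hΩ hM => chiBoundaryDecorrelation_of_twoPoint hΩ hM (hT Ω hΩ hM) (hTf Ω hΩ hM)) hR

/-- **CHI Theorem 1.3 for all `k` from the outputs of the spinor analysis alone** — the two seats'
chains composed: CHI Prop. 2.20 for `k = 1` in its explicit moving-point form (`hR₁`) and CHI Thm. 1.7
(`hB`) give Thm. 1.1 for both boundary conditions (`chi_twoPoint_rho_of_ratios`,
`PlanarIsingTwoPointProofs.lean`, §2.9), which with Prop. 2.20 for all `k` (`hP`, existence of the ratio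
limits) and Remark 2.21 (`hR`, their covariance) give Thm. 1.3 (`chi_multiPoint_rho_of_twoPoint_CHI'`,
§2.10 with Lemma 2.26 proved here). [cite: ChelkakHonglerIzyurovAnnals2015, Thm. 1.3; §§2.9–2.10; Prop. 2.20, Remark 2.21, Thm. 1.7] -/
theorem chi_multiPoint_rho_of_ratios
    (hR₁ : ∀ (Ω : Set ℂ), IsAdmissibleDomain Ω → MeshApproximates Ω → ∀ (φ : ℂ → ℂ),
      IsConformalBijection φ Ω UpperHalfPlane.upperHalfPlaneSet →
        ∀ x ∈ Ω, ∀ (y : ℝ → ℂ) (y₀ y' : ℂ), y₀ ∈ Ω → y' ∈ Ω → y₀ ≠ x → y' ≠ x →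
          Tendsto y (𝓝[>] 0) (𝓝 y₀) →
            Tendsto (fun δ => meshIsingPlusCorr Ω δ ![x, y δ] / meshIsingPlusCorr Ω δ ![x, y'])
              (𝓝[>] 0) (𝓝 (twoPointPlusCHI φ x y₀ / twoPointPlusCHI φ x y')))
    (hB : ∀ (Ω : Set ℂ), IsAdmissibleDomain Ω → MeshApproximates Ω → ∀ (φ : ℂ → ℂ),
      IsConformalBijection φ Ω UpperHalfPlane.upperHalfPlaneSet →
        ∀ x ∈ Ω, ∀ (y : ℝ → ℂ) (y₀ : ℂ), y₀ ∈ Ω → y₀ ≠ x → Tendsto y (𝓝[>] 0) (𝓝 y₀) →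
          Tendsto (fun δ => meshIsingFreeCorr Ω δ ![x, y δ] / meshIsingPlusCorr Ω δ ![x, y δ])
            (𝓝[>] 0) (𝓝 (bCHI (φ x) (φ y₀))))
    (hP : ∀ Ω : Set ℂ, IsAdmissibleDomain Ω → MeshApproximates Ω → CHIRatioLimits Ω)
    (hR : ∀ (Ω Ω' : Set ℂ) (φ : ℂ → ℂ), IsAdmissibleDomain Ω → MeshApproximates Ω →
      IsAdmissibleDomain Ω' → MeshApproximates Ω' → IsConformalBijection φ Ω Ω' →
        CHIRatioCovariance Ω Ω' φ) :
    chi_multiPoint_rho :=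
  have h := chi_twoPoint_rho_of_ratios hR₁ hB
  chi_multiPoint_rho_of_twoPoint_CHI' h.1 h.2 hP hR

end Literature.Probability.LatticeModels
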